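import Literature.RepresentationTheory.BorelWallach2000.U11TranslationDeterminantTwistCommute
import HarnessLib

/-!
# The submodule lattice of a twist: `Submodule R (χ·V) ≃o Submodule R V` for `(𝔤, K)`-data with the same `(𝔤, K)`-submodules;
# length and finite length are twist-invariants; at `U(1,1)`: `ℓ(det^k · M) = ℓ(M)`, `ℓ(ψ^{σ_kχ′}_{F_{m,n+k}}(M)) = ℓ(ψ^{χ′}_{F_{m,n}}(M))`

Family `hodge`, lane `lit-hodgefound` (foundations library; seat `lit-hodgefound-p39`, generation 30, row g30-#4); topic
`RepresentationTheory/BorelWallach2000`; namespaces `Literature.NumberTheory.Automorphic.GKRing` and `….GKTwist` for the part valid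
for every real matrix group `G` (§1–§2), `…BorelWallach2000.U11TranslTwist` (continued) for `U(1,1)` (§3).  Closes the declared
«NOT here» of g30-#1 `U11TranslationDeterminantTwistCommute` («the equality of lengths `ℓ(ψ^{σ_kχ′}_{F_{m,n+k}}(M)) = ℓ(ψ^{χ′}_{F_{m,n}}(M))`
needs the submodule lattice of `det^k · Y`»).  Definitions with bodies + theorems; 0 `sorry`, 0 new axioms, no named fact (net debt 0,
D-0026).

## The sources, verbatim

* A. Borel, N. Wallach, *Continuous Cohomology, Discrete Subgroups, and Representations of Reductive Groups*, 2nd ed. (2000)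
  [BorelWallach2000], I §2.2 (the operator ring: «we get equivalent notions if we replace above `𝔤` and `𝔨` by `R` and `S`» — the
  tree's `GKRing.submoduleEquiv`: `GKRing G`-submodules = `(𝔤, K)`-submodules), II Thm. 5.4 (proof) (twisting a `(𝔤, K)`-module by a
  one-dimensional representation).
* A. W. Knapp, D. A. Vogan, *Cohomological Induction and Unitary Representations* (1995) [KnappVogan1995], §II.3 (2.38) (tensor
  product with a one-dimensional module), Thm. 1.117 (b) (modules over the operator ring `R(𝔤, K)`), §VII.13 Cor. 7.208 (the
  translation functors carry `𝓕(𝔤, K)` into itself).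

## What is formalised

* §1 (any ring `R`, modules `M`, `M′`, an order isomorphism `Submodule R M ≃o Submodule R M′`): **`length_eq_of_submoduleOrderIso`**
  (`Module.length` is the Krull dimension of the submodule lattice), `isFiniteLength_iff_of_submoduleOrderIso`,
  `isSimpleModule_iff_of_submoduleOrderIso` (plumbing over Mathlib's `Order.krullDim_eq_of_orderIso`, `Module.length_ne_top_iff`,
  `OrderIso.isSimpleOrder_iff`).
* §2 (any `G`): for data `(ρK, ρ𝔤)`, `(σK, σ𝔤)` on one space `V` with the same `(𝔤, K)`-submodules, **`GKRing.submoduleOrderIsoOfIff :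
  Submodule R (asModule ρK ρ𝔤) ≃o Submodule R (asModule σK σ𝔤)`** (same carriers: `toSubspace`, `castSubmodule`, `mem_castSubmodule_iff`, `castSubmodule_le_iff`, `mem_submoduleOrderIsoOfIff_iff` —
  every membership statement kept inside ONE module structure, through `GKRing.isGKSubmodule_restrictScalars` / `ofGK`, I §2.2); `GKRing.selfAsModuleEquiv : asModule (actK M) (actLie M) ≃ₗ[R] M` (the
  general-`G` form of `U11TranslConj.selfEquiv`); for the twist by a character (`GKTwist.kAct χ ρK`, `GKTwist.lieAct dχ ρ𝔤`, which «has
  the same `(𝔤, K)`-submodules as the module», the landed `GKTwist.isGKSubmodule_iff`): **`GKTwist.submoduleOrderIso :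
  Submodule R (χ·V) ≃o Submodule R V`**, **`GKTwist.length_eq`** (`ℓ(χ·V) = ℓ(V)`), `GKTwist.isFiniteLength_iff`, `GKTwist.isSimpleModule_iff`.
* §3 (`U(1,1)`, `M` a module over the operator ring): **`U11TranslTwist.twistModSubmoduleOrderIso : Submodule R (det^k · M) ≃o Submodule R M`**,
  **`length_twistMod`** (`ℓ(det^k · M) = ℓ(M)`), `isFiniteLength_twistMod_iff`, `length_tensorFinZero` (`ℓ(M ⊗ det^k) = ℓ(M)`),
  `isFiniteLength_tensorFinZero_iff`, and for g30-#1's det-AFTER law **`length_transl_shift_eq`: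
  `ℓ(ψ^{σ_kχ′}_{F_{m,n+k}}(M)) = ℓ(ψ^{χ′}_{F_{m,n}}(M))`**, `isFiniteLength_transl_shift_iff` (`M ∈ 𝒞_{Zf}`).

Deviations (declared): (i) «twist-invariance of length» is not a numbered statement of the sources — it is bookkeeping of I §2.2
(`R`-submodules = `(𝔤, K)`-submodules) with (2.38) (the twist has the same `(𝔤, K)`-submodules); (ii) lengths are Mathlib's
`Module.length` over the operator ring `R = GKRing G` (possibly `⊤`).

NOT here: Noetherian / Artinian transport separately (finite length = both, `isFiniteLength_iff_isNoetherian_isArtinian`);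
conjugation `V^c` (its lattice statement is `U11TranslationConjugate`'s `subConjEquiv`); general reductive pairs beyond real matrix
groups.  Nothing here is a case of the Hodge conjecture.

Consumed by name: `GKRing.asModule`, `asModuleEquiv`, `actK_asModule`, `actLie_asModule`, `isGKSubmodule_restrictScalars`, `ofGK`,
`smul_eq_lift`, `smul_def` (`GKModuleRing`); `GKTwist.kAct`, `lieAct`, `isGKSubmodule_iff`, `U11Twist.detPow`, `trMul` (`U11DeterminantTwists`);
`U11TranslTwist.twistMod`, `tensorFinZeroEquiv` (`U11TranslationDeterminantTwist`); `U11TranslTwist.translShiftTwistModEquiv`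
(`U11TranslationDeterminantTwistCommute`); `U11Transl.transl`, `isGKModule_transl`, `hasGenInfChar_transl` (`U11TranslationFunctors`);
Mathlib `Module.coe_length`, `Order.krullDim_eq_of_orderIso`, `Module.length_ne_top_iff`, `isSimpleModule_iff`, `OrderIso.isSimpleOrder_iff`,
`Submodule.orderIsoMapComap`, `LinearEquiv.length_eq`.

## References

* A. Borel, N. Wallach, *Continuous Cohomology, Discrete Subgroups, and Representations of Reductive Groups*, 2nd ed., Math. Surveys
  Monogr. 67 (2000), I §2.2; II Thm. 5.4 (proof). [BorelWallach2000]
* A. W. Knapp, D. A. Vogan, *Cohomological Induction and Unitary Representations*, Princeton Math. Ser. 45 (1995), Thm. 1.117 (b);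
  §II.3 (2.38); §VII.13 Cor. 7.208. [KnappVogan1995]
-/

noncomputable section

-- Mathlib idiom (as in `GKModules`, `GKCohomology`, `U11DeterminantTwists`): commutator bracket on `Module.End` / on `ℂ`
attribute [local instance 100] LieRing.ofAssociativeRing

/-! ## §1 Order isomorphisms of submodule lattices transport length, finite length, simplicity -/

namespace Literature.NumberTheory.Automorphic.GKRing

section LatticeTransport

variable {R : Type*} [Ring R] {M : Type*} [AddCommGroup M] [Module R M] {M' : Type*} [AddCommGroup M'] [Module R M']

/-- **`Module.length` is an invariant of the submodule lattice**: an order isomorphism `Submodule R M ≃o Submodule R M′` gives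
`ℓ(M) = ℓ(M′)` (the length is the Krull dimension of the lattice; plumbing). [cite: KnappVogan1995, §VII.13 Cor. 7.208] -/
theorem length_eq_of_submoduleOrderIso (e : Submodule R M ≃o Submodule R M') : Module.length R M = Module.length R M' := by
  have h := Order.krullDim_eq_of_orderIso e
  rw [← Module.coe_length, ← Module.coe_length] at h
  exact_mod_cast h

/-- Finite length is an invariant of the submodule lattice (plumbing). [cite: KnappVogan1995, §VII.13 Cor. 7.208] -/
theorem isFiniteLength_iff_of_submoduleOrderIso (e : Submodule R M ≃o Submodule R M') : IsFiniteLength R M ↔ IsFiniteLength R M' := by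
  rw [← Module.length_ne_top_iff, ← Module.length_ne_top_iff, length_eq_of_submoduleOrderIso e]

/-- Simplicity is an invariant of the submodule lattice (plumbing). [cite: KnappVogan1995, App. A §3 (A.17)] -/
theorem isSimpleModule_iff_of_submoduleOrderIso (e : Submodule R M ≃o Submodule R M') : IsSimpleModule R M ↔ IsSimpleModule R M' := by
  rw [isSimpleModule_iff, isSimpleModule_iff, e.isSimpleOrder_iff]

end LatticeTransport

/-! ## §2 Data with the same `(𝔤, K)`-submodules have order-isomorphic lattices of submodules over the operator ring -/

section SameSubmodules

variable {A : Type*} [NormedCommRing A] [NormedAlgebra ℝ A] [NormedAlgebra ℚ A] [CompleteSpace A]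
  [StarRing A] {N : Type*} [Fintype N] [DecidableEq N] {G : RealMatrixGroup A N}
  {V : Type*} [AddCommGroup V] [Module ℂ V]
  (ρK : Representation ℂ G.maximalCompact V) (ρ𝔤 : G.lie →ₗ⁅ℝ⁆ Module.End ℂ V)
  (σK : Representation ℂ G.maximalCompact V) (σ𝔤 : G.lie →ₗ⁅ℝ⁆ Module.End ℂ V)

/-- The underlying subspace of an `R`-submodule of `asModule ρK ρ𝔤`, re-read in `asModule σK σ𝔤` (preimage under the identity
`asModule σK σ𝔤 → asModule ρK ρ𝔤`; plumbing that keeps every membership statement inside ONE module structure).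
[cite: BorelWallach2000, I §2.2] -/
def toSubspace (W : Submodule (GKRing G) (asModule ρK ρ𝔤)) : Submodule ℂ (asModule σK σ𝔤) :=
  (W.restrictScalars ℂ).comap ((asModuleEquiv σK σ𝔤).trans (asModuleEquiv ρK ρ𝔤).symm).toLinearMap

/-- Membership in `toSubspace W` (same carrier). [cite: BorelWallach2000, I §2.2] -/
theorem mem_toSubspace_iff (W : Submodule (GKRing G) (asModule ρK ρ𝔤)) (y : asModule σK σ𝔤) :
    y ∈ toSubspace ρK ρ𝔤 σK σ𝔤 W ↔ (asModuleEquiv ρK ρ𝔤).symm (asModuleEquiv σK σ𝔤 y) ∈ W := by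
  rw [toSubspace, Submodule.mem_comap, Submodule.restrictScalars_mem]
  exact Iff.rfl

/-- `toSubspace W` is a `(𝔤, K)`-submodule of `(ρK, ρ𝔤)` (it IS `W` as a subspace of `V`). [cite: BorelWallach2000, I §2.2] -/
theorem isGKSubmodule_toSubspace (W : Submodule (GKRing G) (asModule ρK ρ𝔤)) :
    IsGKSubmodule ρK ρ𝔤 (toSubspace ρK ρ𝔤 σK σ𝔤 W) := by
  have hW := isGKSubmodule_restrictScalars G (asModule ρK ρ𝔤) W
  rw [actK_asModule, actLie_asModule] at hW
  -- memberships of `IsGKSubmodule ρK ρ𝔤 ·` live in `Submodule ℂ V`; move them through `mem_toSubspace_iff` by `Iff.mp/mpr` terms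
  refine ⟨fun k w hw => ?_, fun X w hw => ?_⟩
  · have hw' := (mem_toSubspace_iff ρK ρ𝔤 σK σ𝔤 W w).mp hw
    exact (mem_toSubspace_iff ρK ρ𝔤 σK σ𝔤 W _).mpr
      ((Submodule.restrictScalars_mem ℂ W _).mp (hW.1 k _ ((Submodule.restrictScalars_mem ℂ W _).mpr hw')))
  · have hw' := (mem_toSubspace_iff ρK ρ𝔤 σK σ𝔤 W w).mp hw
    exact (mem_toSubspace_iff ρK ρ𝔤 σK σ𝔤 W _).mpr
      ((Submodule.restrictScalars_mem ℂ W _).mp (hW.2 X _ ((Submodule.restrictScalars_mem ℂ W _).mpr hw')))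

/-- **The re-reading of an `R`-submodule of `asModule ρK ρ𝔤` as an `R`-submodule of `asModule σK σ𝔤`** when the two data have the
same `(𝔤, K)`-submodules (same carrier; `GKRing.ofGK` of the underlying subspace). [cite: BorelWallach2000, I §2.2] -/
def castSubmodule (h : ∀ W : Submodule ℂ V, IsGKSubmodule ρK ρ𝔤 W ↔ IsGKSubmodule σK σ𝔤 W)
    (W : Submodule (GKRing G) (asModule ρK ρ𝔤)) : Submodule (GKRing G) (asModule σK σ𝔤) :=
  ofGK (toSubspace ρK ρ𝔤 σK σ𝔤 W) (by
    rw [actK_asModule, actLie_asModule]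
    exact (h _).mp (isGKSubmodule_toSubspace ρK ρ𝔤 σK σ𝔤 W))

/-- Membership in `castSubmodule h W` is membership in `W` (same carrier). [cite: BorelWallach2000, I §2.2] -/
theorem mem_castSubmodule_iff (h : ∀ W : Submodule ℂ V, IsGKSubmodule ρK ρ𝔤 W ↔ IsGKSubmodule σK σ𝔤 W)
    (W : Submodule (GKRing G) (asModule ρK ρ𝔤)) (y : asModule σK σ𝔤) :
    y ∈ castSubmodule ρK ρ𝔤 σK σ𝔤 h W ↔ (asModuleEquiv ρK ρ𝔤).symm (asModuleEquiv σK σ𝔤 y) ∈ W := by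
  rw [castSubmodule, mem_ofGK, mem_toSubspace_iff]

/-- Re-reading twice is the identity. [cite: BorelWallach2000, I §2.2] -/
theorem castSubmodule_castSubmodule (h : ∀ W : Submodule ℂ V, IsGKSubmodule ρK ρ𝔤 W ↔ IsGKSubmodule σK σ𝔤 W)
    (W : Submodule (GKRing G) (asModule ρK ρ𝔤)) :
    castSubmodule σK σ𝔤 ρK ρ𝔤 (fun W' => (h W').symm) (castSubmodule ρK ρ𝔤 σK σ𝔤 h W) = W :=
  Submodule.ext fun x => by
    rw [mem_castSubmodule_iff, mem_castSubmodule_iff]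
    exact Iff.rfl

/-- Re-reading preserves and reflects inclusions. [cite: BorelWallach2000, I §2.2] -/
theorem castSubmodule_le_iff (h : ∀ W : Submodule ℂ V, IsGKSubmodule ρK ρ𝔤 W ↔ IsGKSubmodule σK σ𝔤 W)
    (a b : Submodule (GKRing G) (asModule ρK ρ𝔤)) :
    castSubmodule ρK ρ𝔤 σK σ𝔤 h a ≤ castSubmodule ρK ρ𝔤 σK σ𝔤 h b ↔ a ≤ b := by
  constructor
  · intro hab x hx
    have h1 : (asModuleEquiv σK σ𝔤).symm (asModuleEquiv ρK ρ𝔤 x) ∈ castSubmodule ρK ρ𝔤 σK σ𝔤 h a := by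
      rw [mem_castSubmodule_iff]
      exact hx
    have h2 := hab h1
    rw [mem_castSubmodule_iff] at h2
    exact h2
  · intro hab y hy
    rw [mem_castSubmodule_iff] at hy ⊢
    exact hab hy

/-- **Two `(𝔤, K)`-data on one space `V` with the same `(𝔤, K)`-submodules carry order-isomorphic lattices of submodules over the
operator ring** (same underlying subspaces): `R`-submodules of `asModule ρK ρ𝔤` are the `(𝔤, K)`-submodules of `(ρK, ρ𝔤)` («we get
equivalent notions if we replace above `𝔤` and `𝔨` by `R` and `S`»). [cite: BorelWallach2000, I §2.2] -/
def submoduleOrderIsoOfIff (h : ∀ W : Submodule ℂ V, IsGKSubmodule ρK ρ𝔤 W ↔ IsGKSubmodule σK σ𝔤 W) :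
    Submodule (GKRing G) (asModule ρK ρ𝔤) ≃o Submodule (GKRing G) (asModule σK σ𝔤) where
  toFun := castSubmodule ρK ρ𝔤 σK σ𝔤 h
  invFun := castSubmodule σK σ𝔤 ρK ρ𝔤 fun W => (h W).symm
  left_inv := castSubmodule_castSubmodule ρK ρ𝔤 σK σ𝔤 h
  right_inv := castSubmodule_castSubmodule σK σ𝔤 ρK ρ𝔤 fun W => (h W).symm
  map_rel_iff' := castSubmodule_le_iff ρK ρ𝔤 σK σ𝔤 h _ _

/-- `submoduleOrderIsoOfIff h W = castSubmodule h W` (unfolding). [cite: BorelWallach2000, I §2.2] -/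
theorem submoduleOrderIsoOfIff_apply (h : ∀ W : Submodule ℂ V, IsGKSubmodule ρK ρ𝔤 W ↔ IsGKSubmodule σK σ𝔤 W)
    (W : Submodule (GKRing G) (asModule ρK ρ𝔤)) :
    submoduleOrderIsoOfIff ρK ρ𝔤 σK σ𝔤 h W = castSubmodule ρK ρ𝔤 σK σ𝔤 h W :=
  rfl

/-- Membership is unchanged along `submoduleOrderIsoOfIff` (same carriers, through the identifications `asModuleEquiv`).
[cite: BorelWallach2000, I §2.2] -/
theorem mem_submoduleOrderIsoOfIff_iff (h : ∀ W : Submodule ℂ V, IsGKSubmodule ρK ρ𝔤 W ↔ IsGKSubmodule σK σ𝔤 W)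
    (W : Submodule (GKRing G) (asModule ρK ρ𝔤)) (x : asModule σK σ𝔤) :
    x ∈ submoduleOrderIsoOfIff ρK ρ𝔤 σK σ𝔤 h W ↔ (asModuleEquiv ρK ρ𝔤).symm (asModuleEquiv σK σ𝔤 x) ∈ W := by
  rw [submoduleOrderIsoOfIff_apply, mem_castSubmodule_iff]

variable (G)
variable (M : Type*) [AddCommGroup M] [Module ℂ M] [Module (GKRing G) M] [IsScalarTower ℂ (GKRing G) M]

/-- **`asModule (actK M) (actLie M) ≃ₗ[R] M`**: a module over the operator ring, re-read through its own `(𝔤, K)`-data, is itself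
(the identity map; `R`-linear by `GKRing.smul_eq_lift` — the general-`G` form of `U11TranslConj.selfEquiv`).
[cite: KnappVogan1995, Thm. 1.117 (b)] -/
def selfAsModuleEquiv : asModule (actK G M) (actLie G M) ≃ₗ[GKRing G] M :=
  { asModuleEquiv (actK G M) (actLie G M) with
    map_smul' := fun r x => by
      show asModuleEquiv _ _ (r • x) = r • asModuleEquiv _ _ x
      rw [smul_eq_lift G M r (asModuleEquiv _ _ x), smul_def]
      rfl }

/-- `selfAsModuleEquiv` is the identity on carriers. [cite: KnappVogan1995, Thm. 1.117 (b)] -/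
theorem selfAsModuleEquiv_apply (x : asModule (actK G M) (actLie G M)) : selfAsModuleEquiv G M x = asModuleEquiv _ _ x :=
  rfl

end SameSubmodules

end Literature.NumberTheory.Automorphic.GKRing

namespace Literature.NumberTheory.Automorphic.GKTwist

section Twist

variable {A : Type*} [NormedCommRing A] [NormedAlgebra ℝ A] [NormedAlgebra ℚ A] [CompleteSpace A]
  [StarRing A] {N : Type*} [Fintype N] [DecidableEq N] {G : RealMatrixGroup A N}
  {V : Type*} [AddCommGroup V] [Module ℂ V]
  (χ : G.maximalCompact →* ℂ) (dχ : G.lie →ₗ⁅ℝ⁆ ℂ)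
  (ρK : Representation ℂ G.maximalCompact V) (ρ𝔤 : G.lie →ₗ⁅ℝ⁆ Module.End ℂ V)

/-- **The submodule lattice of a twist: `Submodule R (χ·V) ≃o Submodule R V`** over the operator ring — the twist `(χ·ρK, ρ𝔤 + dχ)` has
the same `(𝔤, K)`-submodules as `(ρK, ρ𝔤)` (the landed `isGKSubmodule_iff`). [cite: KnappVogan1995, §II.3 (2.38)]
[cite: BorelWallach2000, I §2.2, II Thm. 5.4 (proof)] -/
def submoduleOrderIso : Submodule (GKRing G) (GKRing.asModule (kAct χ ρK) (lieAct dχ ρ𝔤)) ≃o Submodule (GKRing G) (GKRing.asModule ρK ρ𝔤) :=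
  GKRing.submoduleOrderIsoOfIff (kAct χ ρK) (lieAct dχ ρ𝔤) ρK ρ𝔤 (isGKSubmodule_iff χ dχ ρK ρ𝔤)

/-- **`ℓ(χ·V) = ℓ(V)`: twisting by a character preserves the length over the operator ring.** [cite: KnappVogan1995, §II.3 (2.38)]
[cite: BorelWallach2000, II Thm. 5.4 (proof)] -/
theorem length_eq :
    Module.length (GKRing G) (GKRing.asModule (kAct χ ρK) (lieAct dχ ρ𝔤)) = Module.length (GKRing G) (GKRing.asModule ρK ρ𝔤) :=
  GKRing.length_eq_of_submoduleOrderIso (submoduleOrderIso χ dχ ρK ρ𝔤)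

/-- Twisting by a character preserves finite length. [cite: KnappVogan1995, §II.3 (2.38), §VII.13 Cor. 7.208] -/
theorem isFiniteLength_iff :
    IsFiniteLength (GKRing G) (GKRing.asModule (kAct χ ρK) (lieAct dχ ρ𝔤)) ↔ IsFiniteLength (GKRing G) (GKRing.asModule ρK ρ𝔤) :=
  GKRing.isFiniteLength_iff_of_submoduleOrderIso (submoduleOrderIso χ dχ ρK ρ𝔤)

/-- Twisting by a character preserves simplicity over the operator ring (lattice form of the landed `isIrreducibleGK_iff`).
[cite: KnappVogan1995, §II.3 (2.38)] -/
theorem isSimpleModule_iff :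
    IsSimpleModule (GKRing G) (GKRing.asModule (kAct χ ρK) (lieAct dχ ρ𝔤)) ↔ IsSimpleModule (GKRing G) (GKRing.asModule ρK ρ𝔤) :=
  GKRing.isSimpleModule_iff_of_submoduleOrderIso (submoduleOrderIso χ dχ ρK ρ𝔤)

end Twist

end Literature.NumberTheory.Automorphic.GKTwist

/-! ## §3 `U(1,1)`: `ℓ(det^k · M) = ℓ(M)`, `ℓ(M ⊗ det^k) = ℓ(M)`, `ℓ(ψ^{σ_kχ′}_{F_{m,n+k}}(M)) = ℓ(ψ^{χ′}_{F_{m,n}}(M))` -/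

open scoped Matrix ComplexConjugate TensorProduct
open Polynomial

namespace Literature.RepresentationTheory.BorelWallach2000

open Literature.Algebra.Lie Literature.Algebra.Lie.ChevalleyEilenberg
open Literature.NumberTheory.Automorphic
open Literature.RepresentationTheory.KonnoKonno2007 Literature.RepresentationTheory.KonnoKonno2007.RealDualPair
open Literature.RepresentationTheory.KonnoKonno2007.RealDualPair.UForm
open U11HolDS

-- carriers `↥W` over `GKRing G11` with their `ℂ`-structures (as in `GKModuleRing` §7–§8)
set_option maxSynthPendingDepth 4

namespace U11TranslTwist

open U11FinRep (Fm lieAct kAct)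
open U11Primary (HasGenInfChar primary)
open U11HC (IsZCFinite)
open U11Transl (tensorFin transl isGKModule_tensorFin isGKModule_transl isZCFinite_tensorFin)
open U11Twist (detPow trMul)

section TwistMod

variable (M : Type*) [AddCommGroup M] [Module ℂ M] [Module (GKRing G11) M] [IsScalarTower ℂ (GKRing G11) M] (k : ℤ)

/-- **`Submodule R (det^k · M) ≃o Submodule R M`**: the determinant twist has the same lattice of `(𝔤, K)`-submodules
(§2 for the character `det^k`, then `asModule (actK M) (actLie M) ≃ M`). [cite: BorelWallach2000, II Thm. 5.4 (proof), I §2.2] -/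
def twistModSubmoduleOrderIso : Submodule (GKRing G11) (twistMod M k) ≃o Submodule (GKRing G11) M :=
  (GKTwist.submoduleOrderIso (detPow k) (trMul k) (GKRing.actK G11 M) (GKRing.actLie G11 M)).trans
    (Submodule.orderIsoMapComap (GKRing.selfAsModuleEquiv G11 M))

/-- **`ℓ(det^k · M) = ℓ(M)`.** [cite: BorelWallach2000, II Thm. 5.4 (proof)] [cite: KnappVogan1995, §II.3 (2.38)] -/
theorem length_twistMod : Module.length (GKRing G11) (twistMod M k) = Module.length (GKRing G11) M :=
  GKRing.length_eq_of_submoduleOrderIso (twistModSubmoduleOrderIso M k)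

/-- `det^k · M` has finite length iff `M` has. [cite: BorelWallach2000, II Thm. 5.4 (proof)] [cite: KnappVogan1995, §VII.13 Cor. 7.208] -/
theorem isFiniteLength_twistMod_iff : IsFiniteLength (GKRing G11) (twistMod M k) ↔ IsFiniteLength (GKRing G11) M :=
  GKRing.isFiniteLength_iff_of_submoduleOrderIso (twistModSubmoduleOrderIso M k)

/-- **`ℓ(M ⊗ det^k) = ℓ(M)`** (`M ⊗ F_{0,k} ≅ det^k · M`, the landed `tensorFinZeroEquiv`). [cite: KnappVogan1995, §II.3 (2.38), §VII.13 Cor. 7.208] -/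
theorem length_tensorFinZero : Module.length (GKRing G11) (tensorFin M 0 k) = Module.length (GKRing G11) M := by
  rw [(tensorFinZeroEquiv M k).length_eq, length_twistMod]

/-- `M ⊗ det^k` has finite length iff `M` has. [cite: KnappVogan1995, §VII.13 Cor. 7.208] -/
theorem isFiniteLength_tensorFinZero_iff : IsFiniteLength (GKRing G11) (tensorFin M 0 k) ↔ IsFiniteLength (GKRing G11) M := by
  rw [← Module.length_ne_top_iff, ← Module.length_ne_top_iff, length_tensorFinZero]

end TwistMod

section Shift

variable {M : Type*} [AddCommGroup M] [Module ℂ M] [Module (GKRing G11) M] [IsScalarTower ℂ (GKRing G11) M]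
  (hM : IsGKModule G11 (GKRing.actK G11 M) (GKRing.actLie G11 M)) (hZC : IsZCFinite (GKRing.actLie G11 M))
  (m : ℕ) (n k : ℤ) {n' : ℤ}

include hZC in
/-- **`ℓ(ψ^{σ_kχ′}_{F_{m,n′}}(M)) = ℓ(ψ^{χ′}_{F_{m,n}}(M))`** (`n + k = n′`, `M ∈ 𝒞_{Zf}(𝔤, K)`): the det-AFTER law of g30-#1
(`translShiftTwistModEquiv : ψ^{σ_kχ′}_{F_{m,n′}}(M) ≃ det^k · ψ^{χ′}_{F_{m,n}}(M)`) and `ℓ(det^k · Y) = ℓ(Y)`.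
[cite: KnappVogan1995, §VII.8 (7.141), §VII.13 Cor. 7.208] [cite: BorelWallach2000, II Thm. 5.4 (proof)] -/
theorem length_transl_shift_eq (h : n + k = n') (μ' lam' : ℂ) :
    Module.length (GKRing G11) (transl hM m n' (μ' + 2 * k * Complex.I) (lam' + 2 * k * k - 2 * k * Complex.I * μ')) =
      Module.length (GKRing G11) (transl hM m n μ' lam') := by
  rw [(translShiftTwistModEquiv hM hZC m n k h μ' lam').length_eq, length_twistMod]

include hZC in
/-- `ψ^{σ_kχ′}_{F_{m,n′}}(M)` has finite length iff `ψ^{χ′}_{F_{m,n}}(M)` has (`n + k = n′`). [cite: KnappVogan1995, §VII.13 Cor. 7.208] -/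
theorem isFiniteLength_transl_shift_iff (h : n + k = n') (μ' lam' : ℂ) :
    IsFiniteLength (GKRing G11) (transl hM m n' (μ' + 2 * k * Complex.I) (lam' + 2 * k * k - 2 * k * Complex.I * μ')) ↔
      IsFiniteLength (GKRing G11) (transl hM m n μ' lam') := by
  rw [← Module.length_ne_top_iff, ← Module.length_ne_top_iff, length_transl_shift_eq hM hZC m n k h]

end Shift

end U11TranslTwist

end Literature.RepresentationTheory.BorelWallach2000
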